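import Mathlib
import Summits.KontsevichZagierPeriods.Zeta5Search.WedgeDictionary
import HarnessLib

/-!
# Brown's odd family `σ = (8,2,7,3,6,4,1,5)` on `M_{0,8}` (= `₈π₈`) in Brown–Zudilin's dual coordinates, and his three `ζ(3)`-free examples

HONEST FRAMING: systematic search; no irrationality claim unless certified.

Cell `pub-zeta5`, family-designer seat `fam-brown8` generation 4 (staged for filing; see
`run/shared/lean/pub/pub-zeta5/families/brown8/FAMILY.md` v4 §3.3).  Brown (arXiv:1412.6508, §5.3.3) considers the
generalised cellular integrals `I(a₁,…,a₇; b)` (`b = b₅₈`) of the configuration `σ = (8,2,7,3,6,4,1,5)` and prints three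
examples in which the coefficient of `ζ(3)` vanishes ("tantalisingly … could be part of an infinite sequence of
approximations to `ζ(5)` … or could just be accidental").  Brown–Zudilin (arXiv:2210.03391, §9, display after (35), p. 25)
state that the very-well-poised integral `F₇(b)` IS this generalised cellular integral, with Brown's exponents
`a_{i,j}, b_{i,j}` equal to the exponents of (33).  Matching the integrand of §5.3.3 with (33) term by term gives the
EXPONENT DICTIONARY `bzOfBrown` below (a linear isomorphism `ℤ⁸ ≃ ℤ⁸`, inverse `brownOfBZ`), under which
* Brown's printed denominator exponents `b₂₇, b₃₇, b₃₆, b₄₆, b₁₄, b₁₅` are `b₀−b₆−b₇, b₀−b₁−b₄, b₀−b₅−b₆, b₀−b₃−b₄, b₃,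
  b₀−b₂−b₃` (`brown_denominators`), the six factorials of (35) are `a₂! a₇! a₁! a₅! a₃! a₆!` (`bz35_arguments`),
  and `d(b) = 3b₀ − Σ b_j = a₅+a₆+a₇−b` (`dOf_bzOfBrown`);
* Brown's REDUCED CONVERGENCE CONDITIONS are exactly the PATH CONE `pathCone` (`brownConvergent_iff`): `b₁,b₄,b₅,b₆,b₇ ≥ 0`,
  the six pair sums `b₂+b₇, b₁+b₆, b₄+b₅, b₃+b₅, b₄+b₆, b₁+b₇ ≤ b₀` (consecutive pairs along the path `2–7–1–6–4–5–3`),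
  `d ≥ −1`; `b₂ = b₅₈` and `b₃ = b₁₄` are NOT sign-constrained by convergence.  On the sub-cone `hCone` (`b₂, b₃ ≥ 0`, where
  (34)/(35) make sense) the tree's decomposition theorem applies (`decomposition_of_HCone`):
  `F̃₇(b) = U(b)ζ(5) + W(b)ζ(3) − V(b)` with the canonical coefficients of `WedgeDictionary`.

KERNEL CERTIFICATES (this file's theorems; everything by `decide`/`norm_num`/`ring`): Brown's three examples map to
`b = (2;1,0,1,1,1,1,1)`, `(4;2,0,2,2,2,2,2)`, `(8;3,2,3,5,3,3,3)` (`bzOfBrown_xEx1/2/3`); their partial-fraction tables are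
certified (`isPFData_bEx1/2/3`) and give `(U,W,V) = (2,0,2)`, `(2,0,33/16)`, `(15,0,161263/10368)`; hence the THEOREMS
`F̃₇(2;1,0,1⁵) = 2ζ(5) − 2`, `F̃₇(4;2,0,2⁵) = 2ζ(5) − 33/16`, `4·F̃₇(8;3,2,3,5,3,3,3) = 60ζ(5) − 161263/2592` — Brown's printed
right-hand sides (his normalisation is `I = N(b)·F̃₇(b)` with `N` the prefactor (35), here `1, 1, 4`).  The first two are the
cases `m = 1, 2` of the single-pole family `R_{(2m;0,m⁶)}(t) = 2/(t+m+1)^5` (value `2ζ(5) − 2H_m^{(5)}`); the third is a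
genuine three-pole cancellation `144 − 288 + 144 = 0` in the order-3 row, and lies OUTSIDE Brown–Zudilin's stated range
`b₀ ≥ 2b_j` (`b₄ = 5`).  What is NOT claimed here: the identification `I(a;b) = N(b)F̃₇(b)` itself (Brown–Zudilin's printed
statement, checked by the cell exactly on these three examples and on Zudilin's `₈π₈(n)`, not formalised), and any statement
about other exponents (the cell's exhaustive census of the zero set of `W` for `b₀ ≤ 18` is recorded in FAMILY.md, not here).
-/

noncomputable section
open Finset Polynomial

namespace Summit.KontsevichZagierPeriods.Zeta5Search.Brown8.OddFamily

open Summit.KontsevichZagierPeriods.Zeta5Search.DualSeries (InBox numPoly eval_numPoly)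
open Summit.KontsevichZagierPeriods.Zeta5Search.WedgeDictionary (IsPFData coeffU coeffW coeffV coeffU_eq coeffW_eq
  coeffV_eq dOf vwp_decomposition)
open Literature.NumberTheory.Irrationality.BrownZudilin2022 (vwpDual)
open Literature.NumberTheory.Transcendental (zetaValue)
open Literature.NumberTheory.Transcendental.BallRivoal (pfEval poch harm)
/-! ### The exponent dictionary `(a₁,…,a₇; b) ↔ (b₀; b₁,…,b₇)` -/

/-- Brown's parameters `x = (a₁,…,a₇, b)` of §5.3.3 (`x i = a_{i+1}` for `i ≤ 6`, `x 7 = b = b₅₈`; `a₈ = a₂+a₃+a₄−a₆−a₇` by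
`H_σ`) ↦ Brown–Zudilin's dual parameters `(b₀; b₁,…,b₇)` of (33)–(35) (junk `0` beyond index `7`, as for `bOfA`). -/
def bzOfBrown (x : Fin 8 → ℤ) : ℕ → ℤ := fun j =>
  if j = 0 then x 0 + x 1 + x 2 + x 3 - x 5 - x 6 + x 7 else
  if j = 1 then x 0 - x 6 + x 7 else
  if j = 2 then x 7 else
  if j = 3 then x 0 + x 1 + x 2 - x 4 - x 5 - x 6 + x 7 else
  if j = 4 then x 0 + x 1 - x 5 - x 6 + x 7 else
  if j = 5 then x 3 else
  if j = 6 then x 2 + x 3 - x 5 else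
  if j = 7 then x 1 + x 2 + x 3 - x 5 - x 6 else 0

/-- The inverse dictionary `(b₀; b₁,…,b₇) ↦ (a₁,…,a₇; b)`:
`a = (b₀−b₂−b₇, b₀−b₁−b₆, b₀−b₄−b₅, b₅, b₀−b₃−b₅, b₀−b₄−b₆, b₀−b₁−b₇)`, `b = b₂`. -/
def brownOfBZ (b : ℕ → ℤ) (i : Fin 8) : ℤ :=
  if i.val = 0 then b 0 - b 2 - b 7 else
  if i.val = 1 then b 0 - b 1 - b 6 else
  if i.val = 2 then b 0 - b 4 - b 5 else
  if i.val = 3 then b 5 else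
  if i.val = 4 then b 0 - b 3 - b 5 else
  if i.val = 5 then b 0 - b 4 - b 6 else
  if i.val = 6 then b 0 - b 1 - b 7 else b 2

/-- `brownOfBZ ∘ bzOfBrown = id`. -/
theorem brownOfBZ_bzOfBrown (x : Fin 8 → ℤ) : brownOfBZ (bzOfBrown x) = x := by
  funext i
  fin_cases i <;> simp [brownOfBZ, bzOfBrown] <;> ring

/-- `bzOfBrown ∘ brownOfBZ = id` on the meaningful indices `j ≤ 7`. -/
theorem bzOfBrown_brownOfBZ (b : ℕ → ℤ) {j : ℕ} (hj : j ≤ 7) : bzOfBrown (brownOfBZ b) j = b j := by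
  interval_cases j <;> simp [brownOfBZ, bzOfBrown] <;> ring

/-- Brown's printed denominator exponents (arXiv:1412.6508 §5.3.3, display after `ω_σ`) in dual coordinates:
`b₂₇ = b₀−b₆−b₇`, `b₃₇ = b₀−b₁−b₄`, `b₃₆ = b₀−b₅−b₆`, `b₄₆ = b₀−b₃−b₄`, `b₁₄ = b₃`, `b₁₅ = b₀−b₂−b₃`; and `a₈ = b₇`,
`b₅₈ = b₂`, `a₄ = b₅`. -/
theorem brown_denominators (x : Fin 8 → ℤ) :
    (x 0 + x 5 - x 2 - x 3 + x 7 = bzOfBrown x 0 - bzOfBrown x 6 - bzOfBrown x 7) ∧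
    (x 2 + x 3 + x 6 - x 0 - x 7 = bzOfBrown x 0 - bzOfBrown x 1 - bzOfBrown x 4) ∧
    (x 0 + x 1 - x 3 - x 6 + x 7 = bzOfBrown x 0 - bzOfBrown x 5 - bzOfBrown x 6) ∧
    (x 3 + x 4 + x 5 + x 6 - x 0 - x 1 - x 7 = bzOfBrown x 0 - bzOfBrown x 3 - bzOfBrown x 4) ∧
    (x 0 + x 1 + x 2 - x 4 - x 5 - x 6 + x 7 = bzOfBrown x 3) ∧
    (x 3 + x 4 - x 7 = bzOfBrown x 0 - bzOfBrown x 2 - bzOfBrown x 3) ∧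
    (x 1 + x 2 + x 3 - x 5 - x 6 = bzOfBrown x 7) ∧ (x 7 = bzOfBrown x 2) ∧ (x 3 = bzOfBrown x 5) := by
  refine ⟨?_, ?_, ?_, ?_, ?_, ?_, ?_, ?_, ?_⟩ <;> (simp only [bzOfBrown]; norm_num) <;> ring

/-- The six factorial arguments of the prefactor (35), `b₀−b₁−b₆, b₀−b₁−b₇, b₀−b₂−b₇, b₀−b₃−b₅, b₀−b₄−b₅, b₀−b₄−b₆`, are
Brown's numerator exponents `a₂, a₇, a₁, a₅, a₃, a₆` (so (35) reads `N = a₁!a₂!a₃!a₅!a₆!a₇!/(b₅₈! b₁₄!)`). -/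
theorem bz35_arguments (x : Fin 8 → ℤ) :
    bzOfBrown x 0 - bzOfBrown x 1 - bzOfBrown x 6 = x 1 ∧ bzOfBrown x 0 - bzOfBrown x 1 - bzOfBrown x 7 = x 6 ∧
    bzOfBrown x 0 - bzOfBrown x 2 - bzOfBrown x 7 = x 0 ∧ bzOfBrown x 0 - bzOfBrown x 3 - bzOfBrown x 5 = x 4 ∧
    bzOfBrown x 0 - bzOfBrown x 4 - bzOfBrown x 5 = x 2 ∧ bzOfBrown x 0 - bzOfBrown x 4 - bzOfBrown x 6 = x 5 := by
  refine ⟨?_, ?_, ?_, ?_, ?_, ?_⟩ <;> (simp only [bzOfBrown]; norm_num) <;> ring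

/-- `d(b) = 3b₀ − Σ_j b_j = a₅ + a₆ + a₇ − b` (Brown's third convergence form is `d + 1 ≥ 0`). -/
theorem dOf_bzOfBrown (x : Fin 8 → ℤ) : dOf (bzOfBrown x) = x 4 + x 5 + x 6 - x 7 := by
  simp only [dOf, bzOfBrown, sum_range_succ, sum_range_zero]
  norm_num
  ring

/-! ### The convergence cone -/

/-- Brown's reduced convergence conditions (loc. cit.): `a_i ≥ 0` for `i ∈ ℤ/8ℤ` (with `a₈ = a₂+a₃+a₄−a₆−a₇`) and
`a₁+b−a₇ ≥ 0`, `a₃+a₄−a₆ ≥ 0`, `a₅+a₆+a₇−b+1 ≥ 0`, `a₁+a₂+b−a₆−a₇ ≥ 0`. -/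
def brownCone : Set (Fin 8 → ℤ) := {x |
  0 ≤ x 0 ∧ 0 ≤ x 1 ∧ 0 ≤ x 2 ∧ 0 ≤ x 3 ∧ 0 ≤ x 4 ∧ 0 ≤ x 5 ∧ 0 ≤ x 6 ∧ 0 ≤ x 1 + x 2 + x 3 - x 5 - x 6 ∧
  0 ≤ x 0 + x 7 - x 6 ∧ 0 ≤ x 2 + x 3 - x 5 ∧ 0 ≤ x 4 + x 5 + x 6 - x 7 + 1 ∧ 0 ≤ x 0 + x 1 + x 7 - x 5 - x 6}

/-- The PATH CONE in dual coordinates: `b₁,b₄,b₅,b₆,b₇ ≥ 0`, the six consecutive pair sums along the path `2–7–1–6–4–5–3`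
are `≤ b₀`, and `d ≥ −1`.  (`b₂`, `b₃` unconstrained.) -/
def pathCone : Set (ℕ → ℤ) := {b |
  0 ≤ b 1 ∧ 0 ≤ b 4 ∧ 0 ≤ b 5 ∧ 0 ≤ b 6 ∧ 0 ≤ b 7 ∧
  b 2 + b 7 ≤ b 0 ∧ b 1 + b 7 ≤ b 0 ∧ b 1 + b 6 ≤ b 0 ∧ b 4 + b 6 ≤ b 0 ∧ b 4 + b 5 ≤ b 0 ∧ b 3 + b 5 ≤ b 0 ∧
  -1 ≤ dOf b}

/-- **Brown's convergence region = the path cone.** -/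
theorem brownConvergent_iff (x : Fin 8 → ℤ) : x ∈ brownCone ↔ bzOfBrown x ∈ pathCone := by
  simp only [brownCone, pathCone, Set.mem_setOf_eq, dOf_bzOfBrown]
  simp only [bzOfBrown]
  norm_num
  omega

/-- The HYPERGEOMETRIC SUB-CONE: the path cone with `b₂ = b₅₈ ≥ 0` and `b₃ = b₁₄ ≥ 0` (where (34) and (35) make sense). -/
def hCone : Set (ℕ → ℤ) := {b | b ∈ pathCone ∧ 0 ≤ b 2 ∧ 0 ≤ b 3}

/-- Auxiliary fact `mem_hCone_iff` (designer helper; docstring added by the filing lane, mathematics verbatim). -/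
theorem mem_hCone_iff (b : ℕ → ℤ) : b ∈ hCone ↔
    (0 ≤ b 1 ∧ 0 ≤ b 4 ∧ 0 ≤ b 5 ∧ 0 ≤ b 6 ∧ 0 ≤ b 7 ∧
      b 2 + b 7 ≤ b 0 ∧ b 1 + b 7 ≤ b 0 ∧ b 1 + b 6 ≤ b 0 ∧ b 4 + b 6 ≤ b 0 ∧ b 4 + b 5 ≤ b 0 ∧ b 3 + b 5 ≤ b 0 ∧
      -1 ≤ dOf b) ∧ 0 ≤ b 2 ∧ 0 ≤ b 3 := by
  simp only [hCone, pathCone, Set.mem_setOf_eq]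

/-- On the hypergeometric sub-cone the hypotheses of the tree's decomposition theorem hold:
`0 ≤ b_j ≤ b₀ + 1` and `Σ_j b_j ≤ 3b₀ + 1`. -/
theorem inBox_of_HCone (b : ℕ → ℤ) (h : b ∈ hCone) :
    InBox b ∧ ∑ j ∈ range 7, b (j + 1) ≤ 3 * b 0 + 1 := by
  rw [mem_hCone_iff] at h
  obtain ⟨⟨h1, h4, h5, h6, h7, p27, p17, p16, p46, p45, p35, hd⟩, h2, h3⟩ := h
  simp only [dOf, sum_range_succ, sum_range_zero] at hd
  refine ⟨⟨by omega, fun j hj => ?_⟩, ?_⟩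
  · have hj' : j < 7 := mem_range.1 hj
    interval_cases j <;> simp only [Nat.reduceAdd] <;> omega
  · simp only [sum_range_succ, sum_range_zero]
    omega

/-- **Decomposition on the hypergeometric sub-cone** (the tree's `vwp_decomposition`):
`F̃₇(b) = U(b)ζ(5) + W(b)ζ(3) − V(b)`. -/
theorem decomposition_of_HCone (b : ℕ → ℤ) (h : b ∈ hCone) :
    vwpDual 7 b = (coeffU b : ℝ) * zetaValue 5 + (coeffW b : ℝ) * zetaValue 3 - (coeffV b : ℝ) :=
  (vwp_decomposition b (inBox_of_HCone b h).1 (inBox_of_HCone b h).2).2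

/-! ### Brown's three examples in dual coordinates -/

/-- Example 1: `I(1,0,0,1,0,0,0; b=0)` i.e. `x = (1,0,0,1,0,0,0,0)`. -/
def xEx1 : Fin 8 → ℤ := ![1, 0, 0, 1, 0, 0, 0, 0]
/-- Example 2: `I(2,0,0,2,0,0,0; b=0)`. -/
def xEx2 : Fin 8 → ℤ := ![2, 0, 0, 2, 0, 0, 0, 0]
/-- Example 3: `I(3,2,0,3,2,0,2; b=2)`. -/
def xEx3 : Fin 8 → ℤ := ![3, 2, 0, 3, 2, 0, 2, 2]

/-- `b = (2; 1,0,1,1,1,1,1)`. -/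
def bEx1 : ℕ → ℤ := fun j => if j = 0 then 2 else if j = 2 then 0 else if j ≤ 7 then 1 else 0
/-- `b = (4; 2,0,2,2,2,2,2)`. -/
def bEx2 : ℕ → ℤ := fun j => if j = 0 then 4 else if j = 2 then 0 else if j ≤ 7 then 2 else 0
/-- `b = (8; 3,2,3,5,3,3,3)`. -/
def bEx3 : ℕ → ℤ := fun j =>
  if j = 0 then 8 else if j = 2 then 2 else if j = 4 then 5 else if j ≤ 7 then 3 else 0

/-- Auxiliary fact `bzOfBrown_xEx1` (designer helper; docstring added by the filing lane, mathematics verbatim). -/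
theorem bzOfBrown_xEx1 : bzOfBrown xEx1 = bEx1 := by
  funext j
  by_cases hj : j ≤ 8
  · interval_cases j <;> decide
  · simp only [bzOfBrown, bEx1]; split_ifs <;> omega

/-- Auxiliary fact `bzOfBrown_xEx2` (designer helper; docstring added by the filing lane, mathematics verbatim). -/
theorem bzOfBrown_xEx2 : bzOfBrown xEx2 = bEx2 := by
  funext j
  by_cases hj : j ≤ 8
  · interval_cases j <;> decide
  · simp only [bzOfBrown, bEx2]; split_ifs <;> omega

/-- Auxiliary fact `bzOfBrown_xEx3` (designer helper; docstring added by the filing lane, mathematics verbatim). -/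
theorem bzOfBrown_xEx3 : bzOfBrown xEx3 = bEx3 := by
  funext j
  by_cases hj : j ≤ 8
  · interval_cases j <;> decide
  · simp only [bzOfBrown, bEx3]; split_ifs <;> omega

/-- All three are Brown-convergent and lie in the hypergeometric sub-cone; example 3 is OUTSIDE Brown–Zudilin's stated
range `b₀ ≥ 2b_j` (`2·b₄ = 10 > 8`). -/
theorem examples_in_HCone : bEx1 ∈ hCone ∧ bEx2 ∈ hCone ∧ bEx3 ∈ hCone ∧ ¬ (2 * bEx3 4 ≤ bEx3 0) := by
  refine ⟨?_, ?_, ?_, by decide⟩ <;>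
  · rw [mem_hCone_iff]
    refine ⟨⟨by decide, by decide, by decide, by decide, by decide, by decide, by decide, by decide, by decide,
      by decide, by decide, ?_⟩, by decide, by decide⟩
    simp only [dOf, sum_range_succ, sum_range_zero]; decide

/-- Single-conclusion witnesses of the three cones (Brown's third example). -/
theorem hCone_bEx3 : bEx3 ∈ hCone := examples_in_HCone.2.2.1

/-- Auxiliary fact `pathCone_bEx3` (designer helper; docstring added by the filing lane, mathematics verbatim). -/
theorem pathCone_bEx3 : bEx3 ∈ pathCone := by
  have h := hCone_bEx3
  simp only [hCone, Set.mem_setOf_eq] at h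
  exact h.1

/-- Auxiliary fact `brownConvergent_xEx3` (designer helper; docstring added by the filing lane, mathematics verbatim). -/
theorem brownConvergent_xEx3 : xEx3 ∈ brownCone := by
  rw [brownConvergent_iff, bzOfBrown_xEx3]; exact pathCone_bEx3

/-! ### Partial-fraction tables (computed exactly by the cell, CERTIFIED below) -/

/-- Partial-fraction data of `R_{(2;1,0,1,1,1,1,1)}(t) = 2/(t+2)^5` (one entry).  -/
def cEx1 : ℕ → ℕ → ℚ := fun o p =>
  if o = 4 ∧ p = 1 then 2 else
  0

/-- Partial-fraction data of `R_{(4;2,0,2,2,2,2,2)}(t) = 2/(t+3)^5` (one entry).  -/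
def cEx2 : ℕ → ℕ → ℚ := fun o p =>
  if o = 4 ∧ p = 2 then 2 else
  0

/-- Partial-fraction data of `R_{(8;3,2,3,5,3,3,3)}(t) = 2(t+1)(t+2)(t+8)(t+9)/((t+4)^5 (t+5)^3 (t+6)^5)` (poles `p = 3,4,5`; the order-3 row is `144, −288, 144`: this is the vanishing of `W`).  -/
def cEx3 : ℕ → ℕ → ℚ := fun o p =>
  if o = 0 ∧ p = 3 then 695 else
  if o = 1 ∧ p = 3 then -695/2 else
  if o = 2 ∧ p = 3 then 144 else
  if o = 3 ∧ p = 3 then -353/8 else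
  if o = 4 ∧ p = 3 then 15/2 else
  if o = 0 ∧ p = 4 then -1390 else
  if o = 2 ∧ p = 4 then -288 else
  if o = 0 ∧ p = 5 then 695 else
  if o = 1 ∧ p = 5 then 695/2 else
  if o = 2 ∧ p = 5 then 144 else
  if o = 3 ∧ p = 5 then 353/8 else
  if o = 4 ∧ p = 5 then 15/2 else
  0

/-! ### The tables ARE the partial-fraction data -/

/-- Auxiliary Pochhammer evaluation `poch_three` (docstring added by the filing lane, mathematics verbatim). -/
theorem poch_three (t : ℚ) : poch (t + 1) 3 = (t + 1) * (t + 2) * (t + 3) := by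
  simp [poch, prod_range_succ]; ring

/-- Auxiliary fact `poch_five` (designer helper; docstring added by the filing lane, mathematics verbatim). -/
theorem poch_five (t : ℚ) : poch (t + 1) 5 = (t + 1) * (t + 2) * (t + 3) * (t + 4) * (t + 5) := by
  simp [poch, prod_range_succ]; ring

/-- `(t+1)_9 = D·M` with `D = (t+1)(t+2)(t+3)(t+7)(t+8)(t+9)`, `M = (t+4)(t+5)(t+6)`. -/
theorem poch_nine (t : ℚ) : poch (t + 1) 9 =
    ((t + 1) * (t + 2) * (t + 3) * (t + 7) * (t + 8) * (t + 9)) * ((t + 4) * (t + 5) * (t + 6)) := by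
  simp [poch, prod_range_succ]; ring

/-- `numPoly_{(2;1,0,1⁵)}(t+1) = (2t+4)((t+1)(t+3))^6`. -/
theorem eval_numPoly_bEx1 (t : ℚ) :
    ((numPoly bEx1).comp (X + C 1)).eval t = (2 * t + 4) * ((t + 1) * (t + 3)) ^ 6 := by
  rw [eval_comp, eval_add, eval_X, eval_C, eval_numPoly]
  simp [bEx1, prod_range_succ, poch]
  ring

/-- `numPoly_{(4;2,0,2⁵)}(t+1) = (2t+6)((t+1)(t+2)(t+4)(t+5))^6`. -/
theorem eval_numPoly_bEx2 (t : ℚ) :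
    ((numPoly bEx2).comp (X + C 1)).eval t = (2 * t + 6) * ((t + 1) * (t + 2) * (t + 4) * (t + 5)) ^ 6 := by
  rw [eval_comp, eval_add, eval_X, eval_C, eval_numPoly]
  simp [bEx2, prod_range_succ, poch]
  ring

/-- `numPoly_{(8;3,2,3,5,3,3,3)}(t+1) = (2t+10)(t+5)·D⁶·M·(t+1)(t+2)(t+8)(t+9)` with `D, M` as in `poch_nine`. -/
theorem eval_numPoly_bEx3 (t : ℚ) :
    ((numPoly bEx3).comp (X + C 1)).eval t =
      (2 * t + 10) * (t + 5) * ((t + 1) * (t + 2) * (t + 3) * (t + 7) * (t + 8) * (t + 9)) ^ 6 *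
        ((t + 4) * (t + 5) * (t + 6)) * ((t + 1) * (t + 2) * (t + 8) * (t + 9)) := by
  rw [eval_comp, eval_add, eval_X, eval_C, eval_numPoly]
  simp [bEx3, prod_range_succ, poch]
  ring

/-- The summand of example 3 in lowest terms: `R(t) = 2(t+1)(t+2)(t+8)(t+9)/((t+4)^5 (t+5)^3 (t+6)^5)`. -/
theorem summand_bEx3 (t : ℚ) (h1 : t + 1 ≠ 0) (h2 : t + 2 ≠ 0) (h3 : t + 3 ≠ 0) (h4 : t + 4 ≠ 0) (h5 : t + 5 ≠ 0)
    (h6 : t + 6 ≠ 0) (h7 : t + 7 ≠ 0) (h8 : t + 8 ≠ 0) (h9 : t + 9 ≠ 0) :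
    ((numPoly bEx3).comp (X + C 1)).eval t / poch (t + 1) ((bEx3 0).toNat + 1) ^ 6 =
      2 * ((t + 1) * (t + 2) * (t + 8) * (t + 9)) / ((t + 4) ^ 5 * (t + 5) ^ 3 * (t + 6) ^ 5) := by
  rw [show (bEx3 0).toNat + 1 = 9 by decide, eval_numPoly_bEx3, poch_nine]
  rw [div_eq_div_iff (by positivity) (by positivity)]
  ring

/-- `cEx1` is the partial-fraction data of `R_{(2;1,0,1⁵)}`. -/
theorem isPFData_bEx1 : IsPFData bEx1 cEx1 := by
  intro t ht
  have hB : (bEx1 0).toNat = 2 := by decide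
  rw [hB] at ht ⊢
  have h1 : t + 1 ≠ 0 := by have := ht 0 (by norm_num); simpa using this
  have h2 : t + 2 ≠ 0 := by have := ht 1 (by norm_num); intro h; apply this; push_cast; linarith
  have h3 : t + 3 ≠ 0 := by have := ht 2 (by norm_num); intro h; apply this; push_cast; linarith
  rw [eval_numPoly_bEx1, poch_three]
  simp only [pfEval, sum_range_succ, sum_range_zero, cEx1]
  norm_num
  rw [show t + 1 + 1 = t + 2 by ring]
  field_simp
  ring

/-- `cEx2` is the partial-fraction data of `R_{(4;2,0,2⁵)}`. -/
theorem isPFData_bEx2 : IsPFData bEx2 cEx2 := by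
  intro t ht
  have hB : (bEx2 0).toNat = 4 := by decide
  rw [hB] at ht ⊢
  have h1 : t + 1 ≠ 0 := by have := ht 0 (by norm_num); simpa using this
  have h2 : t + 2 ≠ 0 := by have := ht 1 (by norm_num); intro h; apply this; push_cast; linarith
  have h3 : t + 3 ≠ 0 := by have := ht 2 (by norm_num); intro h; apply this; push_cast; linarith
  have h4 : t + 4 ≠ 0 := by have := ht 3 (by norm_num); intro h; apply this; push_cast; linarith
  have h5 : t + 5 ≠ 0 := by have := ht 4 (by norm_num); intro h; apply this; push_cast; linarith
  rw [eval_numPoly_bEx2, poch_five]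
  simp only [pfEval, sum_range_succ, sum_range_zero, cEx2]
  norm_num
  rw [show t + 2 + 1 = t + 3 by ring]
  field_simp
  ring

/-- `cEx3` is the partial-fraction data of `R_{(8;3,2,3,5,3,3,3)}`. -/
theorem isPFData_bEx3 : IsPFData bEx3 cEx3 := by
  intro t ht
  have hB : (bEx3 0).toNat = 8 := by decide
  have h1 : t + 1 ≠ 0 := by have := ht 0 (by decide); simpa using this
  have h2 : t + 2 ≠ 0 := by have := ht 1 (by decide); intro h; apply this; push_cast; linarith
  have h3 : t + 3 ≠ 0 := by have := ht 2 (by decide); intro h; apply this; push_cast; linarith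
  have h4 : t + 4 ≠ 0 := by have := ht 3 (by decide); intro h; apply this; push_cast; linarith
  have h5 : t + 5 ≠ 0 := by have := ht 4 (by decide); intro h; apply this; push_cast; linarith
  have h6 : t + 6 ≠ 0 := by have := ht 5 (by decide); intro h; apply this; push_cast; linarith
  have h7 : t + 7 ≠ 0 := by have := ht 6 (by decide); intro h; apply this; push_cast; linarith
  have h8 : t + 8 ≠ 0 := by have := ht 7 (by decide); intro h; apply this; push_cast; linarith
  have h9 : t + 9 ≠ 0 := by have := ht 8 (by decide); intro h; apply this; push_cast; linarith
  rw [summand_bEx3 t h1 h2 h3 h4 h5 h6 h7 h8 h9, hB]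
  simp only [pfEval, sum_range_succ, sum_range_zero, cEx3]
  norm_num
  rw [show t + 3 + 1 = t + 4 by ring, show t + 4 + 1 = t + 5 by ring, show t + 5 + 1 = t + 6 by ring]
  field_simp
  ring

/-! ### The canonical coefficients: `W = 0` three times -/

/-- `(U, W, V)(2;1,0,1⁵) = (2, 0, 2)`. -/
theorem coeff_bEx1 : coeffU bEx1 = 2 ∧ coeffW bEx1 = 0 ∧ coeffV bEx1 = 2 := by
  have hB : (bEx1 0).toNat = 2 := by decide
  refine ⟨?_, ?_, ?_⟩
  · rw [coeffU_eq isPFData_bEx1, hB]; simp only [sum_range_succ, sum_range_zero, cEx1]; norm_num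
  · rw [coeffW_eq isPFData_bEx1, hB]; simp only [sum_range_succ, sum_range_zero, cEx1]; norm_num
  · rw [coeffV_eq isPFData_bEx1, hB]; simp only [sum_range_succ, sum_range_zero, cEx1, harm]; norm_num

/-- `(U, W, V)(4;2,0,2⁵) = (2, 0, 33/16)`. -/
theorem coeff_bEx2 : coeffU bEx2 = 2 ∧ coeffW bEx2 = 0 ∧ coeffV bEx2 = 33 / 16 := by
  have hB : (bEx2 0).toNat = 4 := by decide
  refine ⟨?_, ?_, ?_⟩
  · rw [coeffU_eq isPFData_bEx2, hB]; simp only [sum_range_succ, sum_range_zero, cEx2]; norm_num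
  · rw [coeffW_eq isPFData_bEx2, hB]; simp only [sum_range_succ, sum_range_zero, cEx2]; norm_num
  · rw [coeffV_eq isPFData_bEx2, hB]; simp only [sum_range_succ, sum_range_zero, cEx2, harm]; norm_num

/-- `(U, W, V)(8;3,2,3,5,3,3,3) = (15, 0, 161263/10368)` — the `ζ(3)`-row cancels: `144 − 288 + 144 = 0`. -/
theorem coeff_bEx3 : coeffU bEx3 = 15 ∧ coeffW bEx3 = 0 ∧ coeffV bEx3 = 161263 / 10368 := by
  have hB : (bEx3 0).toNat = 8 := by decide
  refine ⟨?_, ?_, ?_⟩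
  · rw [coeffU_eq isPFData_bEx3, hB]; simp only [sum_range_succ, sum_range_zero, cEx3]; norm_num
  · rw [coeffW_eq isPFData_bEx3, hB]; simp only [sum_range_succ, sum_range_zero, cEx3]; norm_num
  · rw [coeffV_eq isPFData_bEx3, hB]; simp only [sum_range_succ, sum_range_zero, cEx3, harm]; norm_num

/-! ### The three `ζ(3)`-free evaluations as theorems about `F̃₇ = vwpDual 7` -/

/-- **Example 1**: `F̃₇(2;1,0,1,1,1,1,1) = 2ζ(5) − 2` (Brown: `I(1,0,0,1,0,0,0,0) = 2ζ(5) − 2`; prefactor (35) `= 1`). -/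
theorem vwpDual_bEx1 : vwpDual 7 bEx1 = 2 * zetaValue 5 - 2 := by
  obtain ⟨hU, hW, hV⟩ := coeff_bEx1
  rw [decomposition_of_HCone bEx1 examples_in_HCone.1, hU, hW, hV]
  push_cast
  ring

/-- **Example 2**: `F̃₇(4;2,0,2,2,2,2,2) = 2ζ(5) − 33/16` (Brown: `I(2,0,0,2,0,0,0,0) = 2ζ(5) − 33/16`; prefactor `1`). -/
theorem vwpDual_bEx2 : vwpDual 7 bEx2 = 2 * zetaValue 5 - 33 / 16 := by
  obtain ⟨hU, hW, hV⟩ := coeff_bEx2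
  rw [decomposition_of_HCone bEx2 examples_in_HCone.2.1, hU, hW, hV]
  push_cast
  ring

/-- **Example 3**: `4·F̃₇(8;3,2,3,5,3,3,3) = 60ζ(5) − 161263/2592` (Brown: `I(3,2,0,3,2,0,2,2) = 60ζ(5) − 161263/2592`;
prefactor (35) `= 3!2!0!2!0!2!/(2!3!) = 4`).  A point outside Brown–Zudilin's range `b₀ ≥ 2b_j`. -/
theorem vwpDual_bEx3 : 4 * vwpDual 7 bEx3 = 60 * zetaValue 5 - 161263 / 2592 := by
  obtain ⟨hU, hW, hV⟩ := coeff_bEx3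
  rw [decomposition_of_HCone bEx3 examples_in_HCone.2.2.1, hU, hW, hV]
  push_cast
  ring

end Summit.KontsevichZagierPeriods.Zeta5Search.Brown8.OddFamily
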